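import Literature.NumberTheory.EllipticCurves.BhargavaShankarUpperSieveWeightsProofs
import Literature.NumberTheory.EllipticCurves.BhargavaShankarEq31UpperRouteProofs
import Literature.NumberTheory.EllipticCurves.BhargavaShankarClassWeightsProofs
import Literature.NumberTheory.EllipticCurves.BinaryQuarticRealTypesProofs
import HarnessLib

/-!
# Bhargava–Shankar, Cor. 1.2 (average rank `≤ 3/2`) assembled from the upper congruence count
# (Thm 2.12, upper bound, for `GL₂(ℤ)`-invariant weights modulo `N`) and the local integrals
# `∫ φ_p = |2¹⁰/27|_p M_p(V,F)` (Prop. 3.13 / Cor. 3.12 of the published version)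

`Proofs` file (theorems only: no definitions, no named facts). Source: M. Bhargava, A. Shankar,
*Binary quartic forms having bounded invariants, and the boundedness of the average rank of
elliptic curves*, Ann. of Math. (2) 181 (2015) 191–242; published version (= `arXiv:1006.1002v3`)
§2.5 Thm 2.12 (congruence conditions), §2.7 proof of Thm 2.21 (upper bound:
"`limsup_X N_φ/X^{5/6} ≤ lim_X N/X^{5/6} · ∏_{p<Y} ∫ψ'_{p,⌊Y/p⌋}` … Letting `Y` tend to infinity"),
§3.2 ("it suffices to weight each integral orbit by `1/m(f)`"), Prop. 3.6 (`m = ∏ m_p`),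
Cor. 3.12 / Prop. 3.13 (`∫_{S_p(F)} 1/m_p = |2¹⁰/27|_p Vol(PGL₂(ℤ_p)) M_p(V,F)`), proof of
Thm 3.19; held arXiv text `arXiv:1006.1002v2` §5.4 display (31), Props. 5.7–5.8, Cor. 1.2.

## The statement

By `BhargavaShankarEq31UpperRouteProofs` (tree), Cor. 1.2
(`Literature.NumberTheory.EllipticCurves.averageRankLE_three_halves`) follows from the *upper*
half (U31) of eq. (31): for every `ε > 0`, eventually in `X`,
`Σ_{H(E_{A,B}) < X} #{PGL₂(ℚ)-classes of locally soluble irreducible quartics with the invariants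
of E_{A,B}} ≤ (2 c_F + ε) X^{5/6}`. This file proves (U31) — hence Cor. 1.2
(`averageRankLE_three_halves_of_upperCongruenceCount`) — from exactly two inputs, both written
out in the binders (no named facts):

* **(D) the upper congruence count** (Thm 2.12, upper bound, weighted form): for every modulus
  `N ≥ 1` and every weight `Ψ : (ℤ/Nℤ)⁵ → [0,1]` whose pull-back to `V_ℤ` is
  `GL₂(ℤ)`-invariant, and every `ε > 0`, for all large real `X`: for any finite set `T` of
  `GL₂(ℤ)`-orbits of irreducible integral forms of height `< X` lying in
  `V_ℤ^{(0)} ∪ V_ℤ^{(2+)} ∪ V_ℤ^{(1)}` and any representatives `ρ(O) ∈ O`,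
  `Σ_{O ∈ T} Ψ(ρ(O) mod N) ≤ (ν(Ψ)·(8/27)ζ(2) + ε) X^{5/6}`, `ν(Ψ) = N⁻⁵ Σ_r Ψ(r)`
  (`(4 + 4 + 32)/135 = 8/27`: the constants of Thm 2.1 for the three types; `ζ(2) = π²/6`);
* **(F) the local integrals**: for every prime `p`,
  `∫_{V_{ℤ_p}} φ_p dμ_p = |2¹⁰/3³|_p · M_p(V,F)` for the local sieve weight
  `φ_p = 1_{ℚ_p-soluble} 1_{2⁴F_p^{inv} × 2⁶F_p^{inv}} / m_p` (`M_p(V,F) = localMassV p`, which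
  carries the factor `Vol(PGL₂(ℤ_p)) = 1 − p⁻²`).

## The proof (the printed upper-bound argument, §2.7 and proof of Thm 3.19)

1. Curves with rational `2`-torsion contribute `O(X^{3/4+1/24})` (`#classes ≤ #S₂(E)`, Thm 5.6
   and Prop. 5.8 = `bhargavaShankar_sum_card_selmerTwo_twoTorsion_le_holds`).
2. For the other curves, `#classes(S_{A,B}) = Σ_{O ⊂ S_{A,B}} 1/m(f_O)`
   (`BhargavaShankarClassWeightsProofs`) and `1/m(f) = ∏_p 1/m_p(f) ≤ ∏_{p ∈ P} φ_p(f ⊗ ℤ_p)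
   ≤ ∏_{p ∈ P} ψ'_{p,n}(f ⊗ ℤ_p) = Ψ(f mod N)` for any finite set of primes `P` and level `n`
   (`BhargavaShankarUpperSieveWeightsProofs`), the orbit sets of distinct curves being disjoint.
3. (D) bounds `Σ_O Ψ(f_O mod N)` by `(ν(Ψ)(8/27)ζ(2) + ε₁)(2¹⁰·27·X)^{5/6}`, the forms counted
   being irreducible, of height `< 2¹⁰·27·X`, and not negative definite (locally soluble at `∞`).
4. `ν(Ψ) = ∏_{p ∈ P} ∫ψ'_{p,n}` (Chinese remainder and `μ_p` of congruence classes), which is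
   `≤ ∏_p ∫φ_p + δ` for suitable `P`, `n` (`∫ψ'_{p,n} → ∫φ_p`, dominated convergence; the Euler
   product converges), and `∏_p ∫φ_p = ∏_p |2¹⁰/27|_p M_p(V,F)` by (F); finally
   `(8/27)ζ(2)·(2¹⁰·27)^{5/6}·∏_p |2¹⁰/27|_p M_p(V,F) = 2 c_F` (`eq31_constant`,
   `hasProd_localFactor`, Lemma 5.16 = `brumerKramer_card_quotient_two_holds`).

## References

* M. Bhargava, A. Shankar, Ann. of Math. (2) 181 (2015) 191–242 = arXiv:1006.1002; v3: Thm 2.12,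
  §2.7 proof of Thm 2.21 (upper bound), §3.2, Prop. 3.6, Cor. 3.12, Prop. 3.13, proof of Thm 3.19;
  v2: §5.4 display (31), Props. 5.7–5.8, Cor. 1.2.
  [cite: BhargavaShankarAnnals2015, §2.7 proof of Thm 2.21 (upper bound) and Cor. 1.2 (published numbering)]
-/

noncomputable section

open scoped Classical Topology
open Filter Set MeasureTheory Finset

namespace Literature.NumberTheory.EllipticCurves

namespace BinaryQuartic

/-! ## §1 Orbit bookkeeping -/

/-- `GL₂(ℤ)`-equivalent integral forms have the same invariant `I` (`det = ±1`). [folklore] -/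
theorem GL2ZEquiv.I_eq' {f g : BinaryQuartic ℤ} (h : GL2ZEquiv f g) : g.I = f.I := by
  obtain ⟨γ, hγ, rfl⟩ := h
  rw [I_subst]
  rcases Int.isUnit_iff.mp hγ with h | h <;> rw [h] <;> norm_num

/-- `GL₂(ℤ)`-equivalent integral forms have the same invariant `J` (`det = ±1`). [folklore] -/
theorem GL2ZEquiv.J_eq' {f g : BinaryQuartic ℤ} (h : GL2ZEquiv f g) : g.J = f.J := by
  obtain ⟨γ, hγ, rfl⟩ := h
  rw [J_subst]
  rcases Int.isUnit_iff.mp hγ with h | h <;> rw [h] <;> norm_num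

/-- **Locally soluble forms are not negative definite**: an integral form with `Δ ≠ 0` that is
soluble over `ℝ` lies in `V_ℤ^{(0)} ∪ V_ℤ^{(2+)} ∪ V_ℤ^{(1)}` (four real roots, positive definite,
or two real roots) — the three types counted in `N(S^F; ·)`.
[cite: BhargavaShankarAnnals2015, §5.4 eq. (31) (V^{(0)} ∪ V^{(2+)} ∪ V^{(1)}; arXiv:1006.1002v2 numbering)] -/
theorem mem_union_three_of_isLocallySoluble {f : BinaryQuartic ℤ} (hls : f.IsLocallySoluble)
    (hΔ : f.disc ≠ 0) : f ∈ fourRealRoots ∪ posDefinite ∪ twoRealRoots := by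
  rcases lt_trichotomy f.disc 0 with hneg | hzero | hpos
  · exact Or.inr hneg
  · exact absurd hzero hΔ
  · by_cases hdef : (f.map (Int.castRingHom ℝ)).IsDefinite
    · rcases hdef with hposdef | hnegdef
      · exact Or.inl (Or.inr hposdef)
      · exfalso
        obtain ⟨x, y, z, hxy, hz⟩ := hls.1
        have h1 := hnegdef x y hxy
        nlinarith [sq_nonneg z]
    · exact Or.inl (Or.inl ⟨hpos, hdef⟩)

/-- `1/m(f) ≤ ∏_{i} 1/m_{q_i}(f)` for any finite family of distinct primes `q_i` (`m = ∏_p m_p`,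
Prop. 3.6, all `m_p ≥ 1`). [cite: BhargavaShankarAnnals2015, Prop. 3.6 (published numbering)] -/
theorem one_div_globalWeight_le_prod {ι : Type*} [Fintype ι] (q : ι → ℕ) [hq : ∀ i, Fact (q i).Prime]
    (hinj : Function.Injective q) (f : BinaryQuartic ℤ) (hΔ : f.disc ≠ 0) :
    (1 : ℝ) / globalWeight f ≤ ∏ i, (1 : ℝ) / localWeight (f.map (Int.castRingHom ℤ_[q i])) := by
  set w : ℕ → ℕ := fun p => localWeightAt p f with hw
  have hw1 : ∀ p, 1 ≤ w p := by
    intro p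
    by_cases hp : p.Prime
    · haveI : Fact p.Prime := ⟨hp⟩
      rw [hw]
      simp only
      rw [localWeightAt_of_prime]
      exact one_le_localWeight _ (cosets_padic_finite_int f hΔ)
    · rw [hw]
      simp only
      rw [localWeightAt_of_not_prime hp]
  have hfin := finite_setOf_localWeightAt_ne_one f hΔ
  have hsupp : Function.mulSupport w ⊆ ↑(Finset.univ.image q ∪ hfin.toFinset) := by
    intro p hp
    rw [Function.mem_mulSupport] at hp
    simp only [Finset.coe_union, Set.mem_union, Finset.mem_coe, Set.Finite.mem_toFinset,
      Set.mem_setOf_eq]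
    exact Or.inr hp
  have hprod : ∏ p ∈ Finset.univ.image q, w p ≤ globalWeight f := by
    rw [globalWeight_eq_finprod_localWeightAt f hΔ, finprod_eq_prod_of_mulSupport_subset w hsupp]
    exact Finset.prod_le_prod_of_subset_of_one_le' Finset.subset_union_left fun p _ _ => hw1 p
  have hpos : 0 < ∏ p ∈ Finset.univ.image q, w p :=
    Finset.prod_pos fun p _ => (hw1 p)
  have himg : ∏ p ∈ Finset.univ.image q, w p = ∏ i, localWeight (f.map (Int.castRingHom ℤ_[q i])) := by
    rw [Finset.prod_image fun i _ j _ h => hinj h]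
    refine Finset.prod_congr rfl fun i _ => ?_
    rw [hw]
    simp only
    rw [localWeightAt_of_prime]
  calc (1 : ℝ) / globalWeight f ≤ 1 / (∏ p ∈ Finset.univ.image q, w p : ℕ) := by
        apply one_div_le_one_div_of_le (by exact_mod_cast hpos)
        exact_mod_cast hprod
    _ = ∏ i, (1 : ℝ) / localWeight (f.map (Int.castRingHom ℤ_[q i])) := by
        rw [himg, Nat.cast_prod, Finset.prod_div_distrib, Finset.prod_const_one]

/-! ## §2 The assembly -/

/-- **The upper half (U31) of eq. (31) from the upper congruence count (D) and the local
integrals (F)**: for every `ε > 0`, eventually in `X`,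
`Σ_{H(E_{A,B}) < X} #{PGL₂(ℚ)-classes of loc. sol. irreducible quartics with invariants
2⁴(−3A), 2⁶(−27B)} ≤ (2 c_F + ε) X^{5/6}` — the printed upper-bound sieve (proof of Thm 2.21)
applied to `φ = ∏_p φ_p` as in the proof of Thm 3.19, with the `2`-torsion curves set aside by
Prop. 5.8. See the module docstring for (D) and (F).
[cite: BhargavaShankarAnnals2015, §2.7 proof of Thm 2.21 (upper bound), proof of Thm 3.19, §5.4 eq. (31) (published / arXiv v2 numbering)] -/
theorem sum_irredClassCount_le_of_upperCongruenceCount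
    (hD : ∀ (N : ℕ) [NeZero N] (Ψ : (Fin 5 → ZMod N) → ℝ), (∀ r, 0 ≤ Ψ r) → (∀ r, Ψ r ≤ 1) →
      (∀ f g : BinaryQuartic ℤ, GL2ZEquiv f g →
        Ψ (fun j => ((g.coeffs j : ℤ) : ZMod N)) = Ψ (fun j => ((f.coeffs j : ℤ) : ZMod N))) →
      ∀ ε : ℝ, 0 < ε → ∀ᶠ X : ℝ in atTop,
        ∀ (T : Finset (Set (BinaryQuartic ℤ))) (ρ : Set (BinaryQuartic ℤ) → BinaryQuartic ℤ),
          (↑T ⊆ gl2zOrbit '' {f : BinaryQuartic ℤ |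
              f ∈ fourRealRoots ∪ posDefinite ∪ twoRealRoots ∧ f.IsIrreducible ∧ f.height < X}) →
          (∀ O ∈ T, ρ O ∈ O) →
          ∑ O ∈ T, Ψ (fun j => (((ρ O).coeffs j : ℤ) : ZMod N)) ≤
            ((∑ r : Fin 5 → ZMod N, Ψ r) / (N : ℝ) ^ 5 * (8 / 27 * (Real.pi ^ 2 / 6)) + ε) *
              X ^ (5 / 6 : ℝ))
    (hF : ∀ (p : ℕ) [Fact p.Prime],
      ∫ f : BinaryQuartic ℤ_[p],
          (if (f.map PadicInt.Coe.ringHom).IsSoluble ∧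
              (∃ IJ ∈ invariantPairsAdic p, f.I = 2 ^ 4 * IJ.1 ∧ f.J = 2 ^ 6 * IJ.2)
            then (1 : ℝ) / localWeight f else 0) =
        ((padicNorm p (2 ^ 10 / 3 ^ 3) : ℚ) : ℝ) * localMassV p) :
    ∀ ε : ℝ, 0 < ε → ∀ᶠ X : ℕ in atTop,
      (∑ AB ∈ heightFamilyBelow X,
          (pgl2QClassCount {f : BinaryQuartic ℤ | f.IsLocallySoluble ∧ f.IsIrreducible ∧
              f.I = 2 ^ 4 * (-3 * AB.1) ∧ f.J = 2 ^ 6 * (-27 * AB.2)} : ℝ)) ≤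
        (2 * heightFamilyConstant + ε) * (X : ℝ) ^ (5 / 6 : ℝ) := by
  intro ε hε
  /- constants -/
  set c₁ : ℝ := (2 : ℝ) ^ 10 * 27 with hc₁
  have hc₁pos : 0 < c₁ := by rw [hc₁]; norm_num
  set κ : ℝ := 8 / 27 * (Real.pi ^ 2 / 6) with hκ
  have hκpos : 0 < κ := by rw [hκ]; positivity
  set A : ℝ := ∏' p : Nat.Primes, ((padicNorm p ((2 : ℚ) ^ 10 / 3 ^ 3) : ℚ) : ℝ) *
    @localMassV p ⟨p.2⟩ with hA
  set E₁₀ : ℝ := ∏' p : Nat.Primes, (1 - 1 / ((p : ℕ) : ℝ) ^ 10) with hE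
  have hAval : A = ((2 : ℝ) ^ 9)⁻¹ * (3 : ℝ)⁻¹ * (6 / Real.pi ^ 2) * E₁₀ :=
    (hasProd_localFactor brumerKramer_card_quotient_two_holds).tprod_eq
  have hconst : κ * c₁ ^ (5 / 6 : ℝ) * A = 2 * heightFamilyConstant := by
    rw [hAval, heightFamilyConstant, hκ, hc₁, ← hE]
    have := eq31_constant
    calc 8 / 27 * (Real.pi ^ 2 / 6) * ((2 : ℝ) ^ 10 * 27) ^ (5 / 6 : ℝ) *
          (((2 : ℝ) ^ 9)⁻¹ * (3 : ℝ)⁻¹ * (6 / Real.pi ^ 2) * E₁₀)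
        = (8 / 27 * (Real.pi ^ 2 / 6) * ((2 : ℝ) ^ 10 * 27) ^ (5 / 6 : ℝ) *
            (((2 : ℝ) ^ 9)⁻¹ * (3 : ℝ)⁻¹ * (6 / Real.pi ^ 2))) * E₁₀ := by ring
      _ = 2 * (4 / ((4 : ℝ) ^ (1 / 3 : ℝ) * (27 : ℝ) ^ (1 / 2 : ℝ))) * E₁₀ := by rw [this]
      _ = 2 * (4 / ((4 : ℝ) ^ (1 / 3 : ℝ) * (27 : ℝ) ^ (1 / 2 : ℝ)) * E₁₀) := by ring
  have hc56 : 0 < c₁ ^ (5 / 6 : ℝ) := Real.rpow_pos_of_pos hc₁pos _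
  /- Step A: the local integrals, and the choice of the primes and of the level -/
  -- `a p = ∫ φ_p`, `b p n = ∫ ψ'_{p,n}`
  set a : Nat.Primes → ℝ := fun p => ((padicNorm p ((2 : ℚ) ^ 10 / 3 ^ 3) : ℚ) : ℝ) *
    @localMassV p ⟨p.2⟩ with ha
  have hAprod : HasProd a A :=
    (hasProd_localFactor brumerKramer_card_quotient_two_holds).multipliable.hasProd
  set b : Nat.Primes → ℕ → ℝ := fun p n =>
    haveI : Fact (p : ℕ).Prime := ⟨p.2⟩
    ∫ f : BinaryQuartic ℤ_[p],
      sSup ((fun g : BinaryQuartic ℤ_[p] =>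
        (if (g.map PadicInt.Coe.ringHom).IsSoluble ∧
              (∃ IJ ∈ invariantPairsAdic p, g.I = 2 ^ 4 * IJ.1 ∧ g.J = 2 ^ 6 * IJ.2)
            then (1 : ℝ) / localWeight g else 0)) ''
        {g : BinaryQuartic ℤ_[p] | ∀ i, ((p : ℕ) : ℤ_[p]) ^ n ∣ g.coeffs i - f.coeffs i}) with hb
  have hb_tendsto : ∀ p : Nat.Primes, Tendsto (b p) atTop (𝓝 (a p)) := by
    intro p
    haveI : Fact (p : ℕ).Prime := ⟨p.2⟩
    have h := tendsto_integral_sSup_sievePhi (p : ℕ)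
    rw [hF (p : ℕ)] at h
    exact h
  set δ : ℝ := ε / (4 * κ * c₁ ^ (5 / 6 : ℝ)) with hδ
  have hδpos : 0 < δ := by rw [hδ]; positivity
  obtain ⟨s, n, hsn⟩ := exists_finset_prod_le_tprod_add hAprod hb_tendsto hδpos
  /- Step B: the level-`N` weight `Ψ` -/
  -- the family of primes
  haveI hfact : ∀ i : ↥s, Fact ((fun i : ↥s => ((i : Nat.Primes) : ℕ)) i).Prime := fun i => ⟨i.1.2⟩
  set q : ↥s → ℕ := fun i => ((i : Nat.Primes) : ℕ) with hq
  have hinj : Function.Injective q := by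
    intro i j h
    exact Subtype.ext (Subtype.ext h)
  haveI hN : NeZero (∏ i, q i ^ n) :=
    ⟨Finset.prod_ne_zero_iff.mpr fun i _ => pow_ne_zero _ (hfact i).out.ne_zero⟩
  -- local weights, envelopes, residue representatives
  set φ : ∀ i : ↥s, BinaryQuartic ℤ_[q i] → ℝ := fun i g =>
    (if (g.map PadicInt.Coe.ringHom).IsSoluble ∧
          (∃ IJ ∈ invariantPairsAdic (q i), g.I = 2 ^ 4 * IJ.1 ∧ g.J = 2 ^ 6 * IJ.2)
        then (1 : ℝ) / localWeight g else 0) with hφ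
  have hφ0 : ∀ i g, 0 ≤ φ i g := fun i g => (sievePhi_nonneg_le_one (q i) g).1
  have hφ1 : ∀ i g, φ i g ≤ 1 := fun i g => (sievePhi_nonneg_le_one (q i) g).2
  set E : ∀ i : ↥s, BinaryQuartic ℤ_[q i] → ℝ := fun i g =>
    sSup (φ i '' {h : BinaryQuartic ℤ_[q i] | ∀ j, (q i : ℤ_[q i]) ^ n ∣ h.coeffs j - g.coeffs j})
    with hEdef
  have hE0 : ∀ i g, 0 ≤ E i g := fun i g => sSup_image_congr_nonneg (hφ0 i) (hφ1 i) n g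
  have hE1 : ∀ i g, E i g ≤ 1 := fun i g => sSup_image_congr_le_one (hφ1 i) n g
  have hφE : ∀ i g, φ i g ≤ E i g := fun i g => le_sSup_image_congr (hφ1 i) n g
  have hEclass : ∀ i (f g : BinaryQuartic ℤ_[q i]),
      (∀ j, (q i : ℤ_[q i]) ^ n ∣ g.coeffs j - f.coeffs j) → E i g = E i f :=
    fun i f g hfg => sSup_image_congr_eq_of_mem (φ i) hfg
  have hEinv : ∀ i (δ' : Matrix (Fin 2) (Fin 2) ℤ_[q i]), δ'.det * δ'.det = 1 →
      ∀ h : BinaryQuartic ℤ_[q i], E i (h.subst δ') = E i h := by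
    intro i δ' hδ' h
    have hunit : IsUnit δ'.det := IsUnit.of_mul_eq_one _ hδ'
    have hinv1 : δ' * δ'⁻¹ = 1 := Matrix.mul_nonsing_inv δ' hunit
    have hinv2 : δ'⁻¹ * δ' = 1 := Matrix.nonsing_inv_mul δ' hunit
    have hdet' : (δ'⁻¹).det * (δ'⁻¹).det = 1 := by
      rw [Matrix.det_nonsing_inv]
      have hri : Ring.inverse δ'.det = δ'.det := by
        calc Ring.inverse δ'.det = Ring.inverse δ'.det * (δ'.det * δ'.det) := by rw [hδ', mul_one]
          _ = δ'.det := by rw [← mul_assoc, Ring.inverse_mul_cancel _ hunit, one_mul]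
      rw [hri, hδ']
    exact sSup_image_congr_subst_eq (hφ1 i) hinv1 hinv2 (sievePhi_subst_eq δ' hδ')
      (sievePhi_subst_eq δ'⁻¹ hdet') n h
  set G : ∀ i : ↥s, (Fin 5 → ZMod (q i ^ n)) → ℝ := fun i r =>
    E i (equivFin5.symm fun j => ((((r j).val : ℕ)) : ℤ_[q i])) with hGdef
  have hGE : ∀ i (g : BinaryQuartic ℤ_[q i]),
      G i (fun j => PadicInt.toZModPow n (g.coeffs j)) = E i g :=
    fun i g => classFn_eq_comp_toZModPow (E i) (hEclass i) g
  have hG0 : ∀ i r, 0 ≤ G i r := fun i r => hE0 i _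
  have hG1 : ∀ i r, G i r ≤ 1 := fun i r => hE1 i _
  -- the weight on `(ℤ/Nℤ)⁵` and its pull-back `Φ`
  set Ψ : (Fin 5 → ZMod (∏ i, q i ^ n)) → ℝ := fun r =>
    ∏ i, G i (fun j => ZMod.castHom (Finset.dvd_prod_of_mem (fun i => q i ^ n) (Finset.mem_univ i))
      (ZMod (q i ^ n)) (r j)) with hΨ
  set Φ : BinaryQuartic ℤ → ℝ := fun f => ∏ i, E i (f.map (Int.castRingHom ℤ_[q i])) with hΦ
  have hΦΨ : ∀ f : BinaryQuartic ℤ, Φ f = Ψ (fun j => ((f.coeffs j : ℤ) : ZMod (∏ i, q i ^ n))) :=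
    fun f => prod_classFn_map_intCast_eq q n E G hGE f
  have hΨ0 : ∀ r, 0 ≤ Ψ r := fun r => (prod_comp_castHom_mem_Icc q n G hG0 hG1 r).1
  have hΨ1 : ∀ r, Ψ r ≤ 1 := fun r => (prod_comp_castHom_mem_Icc q n G hG0 hG1 r).2
  have hΨinv : ∀ f g : BinaryQuartic ℤ, GL2ZEquiv f g →
      Ψ (fun j => ((g.coeffs j : ℤ) : ZMod (∏ i, q i ^ n))) =
        Ψ (fun j => ((f.coeffs j : ℤ) : ZMod (∏ i, q i ^ n))) := by
    intro f g hfg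
    rw [← hΦΨ, ← hΦΨ]
    exact prod_classFn_eq_of_gl2zEquiv q E hEinv hfg
  -- the density of `Ψ`
  have hdens : (∑ r, Ψ r) / ((∏ i, q i ^ n : ℕ) : ℝ) ^ 5 = ∏ p ∈ s, b p n := by
    rw [hΨ, density_prod_classFn_eq_prod_integral q n hinj E G hGE, ← Finset.prod_coe_sort s]
  have hdens_le : (∑ r, Ψ r) / ((∏ i, q i ^ n : ℕ) : ℝ) ^ 5 ≤ A + δ := hdens ▸ hsn
  /- Step C: the congruence count (D) for `Ψ`, along `X' = c₁ X` -/
  set ε₁ : ℝ := ε / (4 * c₁ ^ (5 / 6 : ℝ)) with hε₁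
  have hε₁pos : 0 < ε₁ := by rw [hε₁]; positivity
  have hDΨ := hD (∏ i, q i ^ n) Ψ hΨ0 hΨ1 hΨinv ε₁ hε₁pos
  have hu : Tendsto (fun X : ℕ => c₁ * (X : ℝ)) atTop atTop :=
    Tendsto.const_mul_atTop hc₁pos tendsto_natCast_atTop_atTop
  have hcount := hu.eventually hDΨ
  /- Step D: the `2`-torsion curves (Prop. 5.8) -/
  obtain ⟨C, hC⟩ := bhargavaShankar_sum_card_selmerTwo_twoTorsion_le_holds (1 / 24) (by norm_num)
  have herr : ∀ᶠ X : ℕ in atTop, C * (X : ℝ) ^ (3 / 4 + 1 / 24 : ℝ) ≤ ε / 2 * (X : ℝ) ^ (5 / 6 : ℝ) := by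
    have h1 : Tendsto (fun X : ℕ => C * (X : ℝ) ^ (3 / 4 + 1 / 24 : ℝ) / (X : ℝ) ^ (5 / 6 : ℝ))
        atTop (𝓝 0) := by
      have h2 : Tendsto (fun X : ℕ => C * ((X : ℝ) ^ (-(1 / 24) : ℝ))) atTop (𝓝 (C * 0)) :=
        (tendsto_rpow_neg_atTop (by norm_num : (0 : ℝ) < 1 / 24)).comp
          tendsto_natCast_atTop_atTop |>.const_mul C
      rw [mul_zero] at h2
      refine h2.congr' ?_
      filter_upwards [eventually_gt_atTop 0] with X hX
      have hX0 : (0 : ℝ) < X := by exact_mod_cast hX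
      rw [mul_div_assoc, ← Real.rpow_sub hX0]
      norm_num
    filter_upwards [h1.eventually (gt_mem_nhds (half_pos hε)), eventually_gt_atTop 0] with X hX hX0
    have hXpow : 0 < (X : ℝ) ^ (5 / 6 : ℝ) := Real.rpow_pos_of_pos (by exact_mod_cast hX0) _
    have := (div_lt_iff₀ hXpow).mp hX
    linarith
  /- Step E: assembly -/
  filter_upwards [hcount, herr, eventually_gt_atTop 0] with X hX herrX hX0
  have hXr : (0 : ℝ) < X := by exact_mod_cast hX0
  -- the sets `S_{A,B}` and their orbit sets
  set S : ℤ × ℤ → Set (BinaryQuartic ℤ) := fun AB => {f : BinaryQuartic ℤ | f.IsLocallySoluble ∧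
    f.IsIrreducible ∧ f.I = 2 ^ 4 * (-3 * AB.1) ∧ f.J = 2 ^ 6 * (-27 * AB.2)} with hS
  have hΔAB : ∀ AB ∈ heightFamilyBelow X, 4 * AB.1 ^ 3 + 27 * AB.2 ^ 2 ≠ 0 :=
    fun AB hAB => ((mem_heightFamilyBelow_iff AB X).mp hAB).1.1
  have hfam : ∀ AB ∈ heightFamilyBelow X, IsInHeightFamily AB :=
    fun AB hAB => ((mem_heightFamilyBelow_iff AB X).mp hAB).1
  -- representatives: an element of `O` that is locally soluble and irreducible, if any
  set ρ : Set (BinaryQuartic ℤ) → BinaryQuartic ℤ := fun O =>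
    if h : (O ∩ {f | f.IsLocallySoluble ∧ f.IsIrreducible}).Nonempty then h.some else ⟨0, 0, 0, 0, 0⟩
    with hρ
  have hρmem : ∀ AB O, O ∈ gl2zOrbit '' S AB → ρ O ∈ O ∧ ρ O ∈ S AB := by
    rintro AB O ⟨f, hf, rfl⟩
    have hne : (gl2zOrbit f ∩ {f | f.IsLocallySoluble ∧ f.IsIrreducible}).Nonempty :=
      ⟨f, GL2ZEquiv.refl f, hf.1, hf.2.1⟩
    have hρO : ρ (gl2zOrbit f) = hne.some := by rw [hρ]; simp only [dif_pos hne]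
    have hmem := hne.some_mem
    rw [← hρO] at hmem
    obtain ⟨h1, h2, h3⟩ := hmem
    exact ⟨h1, h2, h3, by rw [GL2ZEquiv.I_eq' h1, hf.2.2.1], by rw [GL2ZEquiv.J_eq' h1, hf.2.2.2]⟩
  -- orbit finsets
  set T : ℤ × ℤ → Finset (Set (BinaryQuartic ℤ)) := fun AB =>
    if h : 4 * AB.1 ^ 3 + 27 * AB.2 ^ 2 ≠ 0 then (finite_gl2zOrbit_image_selmerSet h).toFinset else ∅
    with hT
  have hTmem : ∀ AB ∈ heightFamilyBelow X, ∀ O, O ∈ T AB ↔ O ∈ gl2zOrbit '' S AB := by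
    intro AB hAB O
    rw [hT]
    simp only [dif_pos (hΔAB AB hAB), Set.Finite.mem_toFinset]
    exact Iff.rfl
  -- (1) curve by curve, no `2`-torsion: `#classes = Σ_O 1/m ≤ Σ_O Φ`
  have hcurve : ∀ AB ∈ heightFamilyBelow X, ¬ HasRationalTwoTorsion AB →
      (pgl2QClassCount (S AB) : ℝ) ≤ ∑ O ∈ T AB, Φ (ρ O) := by
    intro AB hAB htors
    have hTor : ∀ r : ℚ, r ^ 3 + AB.1 * r + AB.2 ≠ 0 := fun r hr => htors ⟨r, hr⟩
    have heq := pgl2QClassCount_selmerSet_eq_sum_one_div_globalWeight hTor (hΔAB AB hAB)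
      (r := ρ) (fun O hO => (hρmem AB O hO).1)
    have heqR : (pgl2QClassCount (S AB) : ℝ) =
        ∑ O ∈ (finite_gl2zOrbit_image_selmerSet (hΔAB AB hAB)).toFinset, (1 : ℝ) / globalWeight (ρ O) := by
      have h := congrArg (fun x : ℚ => (x : ℝ)) heq
      simp only [Rat.cast_sum, Rat.cast_div, Rat.cast_one, Rat.cast_natCast] at h
      exact h.symm
    have hTeq : T AB = (finite_gl2zOrbit_image_selmerSet (hΔAB AB hAB)).toFinset := by
      rw [hT]; simp only [dif_pos (hΔAB AB hAB)]
    rw [heqR, ← hTeq]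
    refine Finset.sum_le_sum fun O hO => ?_
    obtain ⟨hOmem, hρS⟩ := hρmem AB O ((hTmem AB hAB O).mp hO)
    have hdisc : (ρ O).disc ≠ 0 := disc_ne_zero_of_I_J_eq (hΔAB AB hAB) hρS.2.2.1 hρS.2.2.2
    calc (1 : ℝ) / globalWeight (ρ O)
        ≤ ∏ i, (1 : ℝ) / localWeight ((ρ O).map (Int.castRingHom ℤ_[q i])) :=
          one_div_globalWeight_le_prod q hinj _ hdisc
      _ = ∏ i, φ i ((ρ O).map (Int.castRingHom ℤ_[q i])) := by
          refine Finset.prod_congr rfl fun i _ => ?_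
          exact (sievePhi_map_intCast_eq (p := q i) (hfam AB hAB) hρS.1 hρS.2.2.1 hρS.2.2.2).symm
      _ ≤ Φ (ρ O) := prod_le_prod_classFn q φ E hφ0 hφE _
  -- (2) the union of the orbit sets over the curves without `2`-torsion
  set F₀ : Finset (ℤ × ℤ) := (heightFamilyBelow X).filter fun AB => ¬ HasRationalTwoTorsion AB with hF₀
  have hdisj : (↑F₀ : Set (ℤ × ℤ)).PairwiseDisjoint T := by
    intro AB hAB AB' hAB' hne
    rw [Finset.mem_coe, hF₀, Finset.mem_filter] at hAB hAB'
    rw [Function.onFun, Finset.disjoint_left]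
    intro O hO hO'
    obtain ⟨f, hf, rfl⟩ := (hTmem AB hAB.1 O).mp hO
    obtain ⟨f', hf', hff'⟩ := (hTmem AB' hAB'.1 _).mp hO'
    have hmem : f' ∈ gl2zOrbit f := by rw [← hff']; exact GL2ZEquiv.refl f'
    have hI := GL2ZEquiv.I_eq' hmem
    have hJ := GL2ZEquiv.J_eq' hmem
    rw [hf.2.2.1, hf'.2.2.1] at hI
    rw [hf.2.2.2, hf'.2.2.2] at hJ
    apply hne
    exact Prod.ext (by linarith) (by linarith)
  set TT : Finset (Set (BinaryQuartic ℤ)) := F₀.biUnion T with hTT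
  have hTTsub : (↑TT : Set (Set (BinaryQuartic ℤ))) ⊆ gl2zOrbit '' {f : BinaryQuartic ℤ |
      f ∈ fourRealRoots ∪ posDefinite ∪ twoRealRoots ∧ f.IsIrreducible ∧ f.height < c₁ * X} := by
    intro O hO
    rw [Finset.mem_coe, hTT, Finset.mem_biUnion] at hO
    obtain ⟨AB, hAB, hO⟩ := hO
    rw [hF₀, Finset.mem_filter] at hAB
    obtain ⟨f, hf, rfl⟩ := (hTmem AB hAB.1 O).mp hO
    refine ⟨f, ⟨?_, hf.2.1, ?_⟩, rfl⟩
    · exact mem_union_three_of_isLocallySoluble hf.1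
        (disc_ne_zero_of_I_J_eq (hΔAB AB hAB.1) hf.2.2.1 hf.2.2.2)
    · have := ((mem_locSolIrredSet_iff X f).mpr ⟨AB, hAB.1, hf⟩).2.2.2
      rw [hc₁]
      exact this
  have hρTT : ∀ O ∈ TT, ρ O ∈ O := by
    intro O hO
    rw [hTT, Finset.mem_biUnion] at hO
    obtain ⟨AB, hAB, hO⟩ := hO
    rw [hF₀, Finset.mem_filter] at hAB
    exact (hρmem AB O ((hTmem AB hAB.1 O).mp hO)).1
  -- (3) the congruence count
  have hmain : ∑ O ∈ TT, Φ (ρ O) ≤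
      ((∑ r, Ψ r) / ((∏ i, q i ^ n : ℕ) : ℝ) ^ 5 * κ + ε₁) * (c₁ * X) ^ (5 / 6 : ℝ) := by
    have h := hX TT ρ hTTsub hρTT
    simp only [← hΦΨ] at h
    exact h
  -- (4) the `2`-torsion part
  have htors : ∑ AB ∈ (heightFamilyBelow X).filter HasRationalTwoTorsion,
      (pgl2QClassCount (S AB) : ℝ) ≤ C * (X : ℝ) ^ (3 / 4 + 1 / 24 : ℝ) := by
    refine le_trans (Finset.sum_le_sum fun AB hAB => ?_) (hC X)
    rw [Finset.mem_filter] at hAB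
    exact_mod_cast irredClassCount_le_card_selmerTwo bhargavaShankar_card_selmerTwo_eq_holds (hfam AB hAB.1)
  -- (5) putting everything together
  have hsplit : ∑ AB ∈ heightFamilyBelow X, (pgl2QClassCount (S AB) : ℝ) =
      ∑ AB ∈ F₀, (pgl2QClassCount (S AB) : ℝ) +
        ∑ AB ∈ (heightFamilyBelow X).filter HasRationalTwoTorsion, (pgl2QClassCount (S AB) : ℝ) := by
    rw [hF₀, add_comm, Finset.sum_filter_add_sum_filter_not]
  have hF₀le : ∑ AB ∈ F₀, (pgl2QClassCount (S AB) : ℝ) ≤ ∑ O ∈ TT, Φ (ρ O) := by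
    rw [hTT, Finset.sum_biUnion hdisj]
    refine Finset.sum_le_sum fun AB hAB => ?_
    rw [hF₀, Finset.mem_filter] at hAB
    exact hcurve AB hAB.1 hAB.2
  have hpow : (c₁ * (X : ℝ)) ^ (5 / 6 : ℝ) = c₁ ^ (5 / 6 : ℝ) * (X : ℝ) ^ (5 / 6 : ℝ) :=
    Real.mul_rpow hc₁pos.le hXr.le
  have hXpow : 0 ≤ (X : ℝ) ^ (5 / 6 : ℝ) := by positivity
  have hνκ : ((∑ r, Ψ r) / ((∏ i, q i ^ n : ℕ) : ℝ) ^ 5 * κ + ε₁) * (c₁ * X) ^ (5 / 6 : ℝ) ≤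
      (2 * heightFamilyConstant + ε / 2) * (X : ℝ) ^ (5 / 6 : ℝ) := by
    rw [hpow, ← mul_assoc]
    refine mul_le_mul_of_nonneg_right ?_ hXpow
    have h1 : (∑ r, Ψ r) / ((∏ i, q i ^ n : ℕ) : ℝ) ^ 5 * κ ≤ (A + δ) * κ :=
      mul_le_mul_of_nonneg_right hdens_le hκpos.le
    have h2 : δ * κ * c₁ ^ (5 / 6 : ℝ) = ε / 4 := by
      rw [hδ]; field_simp
    have h3 : ε₁ * c₁ ^ (5 / 6 : ℝ) = ε / 4 := by
      rw [hε₁]; field_simp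
    calc ((∑ r, Ψ r) / ((∏ i, q i ^ n : ℕ) : ℝ) ^ 5 * κ + ε₁) * c₁ ^ (5 / 6 : ℝ)
        ≤ ((A + δ) * κ + ε₁) * c₁ ^ (5 / 6 : ℝ) := by gcongr
      _ = κ * c₁ ^ (5 / 6 : ℝ) * A + δ * κ * c₁ ^ (5 / 6 : ℝ) + ε₁ * c₁ ^ (5 / 6 : ℝ) := by ring
      _ = 2 * heightFamilyConstant + ε / 2 := by rw [hconst, h2, h3]; ring
  calc ∑ AB ∈ heightFamilyBelow X, (pgl2QClassCount (S AB) : ℝ)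
      = ∑ AB ∈ F₀, (pgl2QClassCount (S AB) : ℝ) +
          ∑ AB ∈ (heightFamilyBelow X).filter HasRationalTwoTorsion, (pgl2QClassCount (S AB) : ℝ) :=
        hsplit
    _ ≤ ∑ O ∈ TT, Φ (ρ O) + C * (X : ℝ) ^ (3 / 4 + 1 / 24 : ℝ) := add_le_add hF₀le htors
    _ ≤ (2 * heightFamilyConstant + ε / 2) * (X : ℝ) ^ (5 / 6 : ℝ) + ε / 2 * (X : ℝ) ^ (5 / 6 : ℝ) :=
        add_le_add (hmain.trans hνκ) herrX
    _ = (2 * heightFamilyConstant + ε) * (X : ℝ) ^ (5 / 6 : ℝ) := by ring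

/-- **Bhargava–Shankar, Cor. 1.2 (`averageRankLE_three_halves`: when elliptic curves over `ℚ` are
ordered by height, `limsup` of the average rank is at most `3/2`) from the upper congruence
count (D) and the local integrals (F)** — through (U31)
(`sum_irredClassCount_le_of_upperCongruenceCount`) and the tree's
`averageRankLE_three_halves_of_sum_irredClassCount_le` (Thm 5.6, Props. 5.7–5.8, Lemma 5.15,
`rank ≤ dim S₂`). No uniformity estimate and no lower bound is needed.
[cite: BhargavaShankarAnnals2015, Cor. 1.2] -/
theorem averageRankLE_three_halves_of_upperCongruenceCount
    (hD : ∀ (N : ℕ) [NeZero N] (Ψ : (Fin 5 → ZMod N) → ℝ), (∀ r, 0 ≤ Ψ r) → (∀ r, Ψ r ≤ 1) →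
      (∀ f g : BinaryQuartic ℤ, GL2ZEquiv f g →
        Ψ (fun j => ((g.coeffs j : ℤ) : ZMod N)) = Ψ (fun j => ((f.coeffs j : ℤ) : ZMod N))) →
      ∀ ε : ℝ, 0 < ε → ∀ᶠ X : ℝ in atTop,
        ∀ (T : Finset (Set (BinaryQuartic ℤ))) (ρ : Set (BinaryQuartic ℤ) → BinaryQuartic ℤ),
          (↑T ⊆ gl2zOrbit '' {f : BinaryQuartic ℤ |
              f ∈ fourRealRoots ∪ posDefinite ∪ twoRealRoots ∧ f.IsIrreducible ∧ f.height < X}) →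
          (∀ O ∈ T, ρ O ∈ O) →
          ∑ O ∈ T, Ψ (fun j => (((ρ O).coeffs j : ℤ) : ZMod N)) ≤
            ((∑ r : Fin 5 → ZMod N, Ψ r) / (N : ℝ) ^ 5 * (8 / 27 * (Real.pi ^ 2 / 6)) + ε) *
              X ^ (5 / 6 : ℝ))
    (hF : ∀ (p : ℕ) [Fact p.Prime],
      ∫ f : BinaryQuartic ℤ_[p],
          (if (f.map PadicInt.Coe.ringHom).IsSoluble ∧
              (∃ IJ ∈ invariantPairsAdic p, f.I = 2 ^ 4 * IJ.1 ∧ f.J = 2 ^ 6 * IJ.2)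
            then (1 : ℝ) / localWeight f else 0) =
        ((padicNorm p (2 ^ 10 / 3 ^ 3) : ℚ) : ℝ) * localMassV p) :
    averageRankLE_three_halves :=
  averageRankLE_three_halves_of_sum_irredClassCount_le
    (sum_irredClassCount_le_of_upperCongruenceCount hD hF)

end BinaryQuartic

end Literature.NumberTheory.EllipticCurves

end
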